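/-
Copyright (c) 2026. All rights reserved.
Released under Apache 2.0 license as described in the file LICENSE.
Authors: abc-iut cell, seat abc-iut-L4-t14 (gen 3; proof-only: the group model `Loc(N, Γ)` of
[AbsTopIII] Prop 4.2 (i) p.106 is id-rigid as soon as the profinite completion of `N_N(Γ)` is SLIM).
-/
import Literature.AnabelianGeometry.AbsoluteAnabelian.LocCategoryGroupModelCompletion
import Literature.AlgebraicGeometry.Frobenioids.Categories
import HarnessLib

/-!
# `Loc(N, Γ)` is id-rigid when the profinite completion of `N_N(Γ)` is slim ([AbsTopIII] Prop 4.2 (i))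

S. Mochizuki, *Topics in absolute anabelian geometry III*, proof of Prop 4.2 (i), kurims manuscript
p. 106 l. 14–19 (`paper:url-5493eb38cbb7`; bib key `MochizukiAbsTopIII2015`): "the full subcategory of
`EA` consisting of objects that map to `X` may … be identified with the category of finite étale
R-localizations '`Loc_R(X)`' …. Thus, the id-rigidity of `EA` follows immediately from the slimness
assertion of Lemma 4.3"; slimness as in [FrdI] §0 p. 13 (the tree's
`Literature.AlgebraicGeometry.Frobenioids.IsSlimGroup`: every open subgroup has trivial centraliser).

PROOF-ONLY file (no new notion), third of abc-iut-L4-t14's group-model chain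
`LocCategoryGroupModel` (p432943: (Z) ⟹ id-rigid) → `LocCategoryGroupModelCompletion` ((Z) ⟸ trivial
centraliser of `η(Γ)` in `M̂`, `M := N_N(Γ)`, `[M : Γ] < ∞`) → here:

* `LocObj.forall_comm_eta_eq_one_of_isSlimGroup` — if `[M : Γ] < ∞` and `M̂ := completion M` is SLIM,
  every `y ∈ M̂` commuting with `η(Γ)` is trivial.  Proof: the kernel `U` of `M̂ → M/K₀` (`K₀` the
  normal core of `Γ` in `M`, of finite index) is an OPEN subgroup in which `η(K₀) ⊆ η(Γ)` is dense
  (`ProfiniteCompletion.denseRange`); commutation with `y` is a closed condition, so `y` centralises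
  `U`, and slimness gives `y = 1`;
* `LocObj.isIdRigid_of_isSlimGroup_completion_normalizer` — **`[N_N(Γ) : Γ] < ∞` and
  `N_N(Γ)^` slim ⟹ `Loc(N, Γ)` id-rigid**: print's sentence in the group model, with "Lemma 4.3"
  entering as the slimness of the completion of `N_N(Γ)` — for `Γ = π₁(X) ≤ N = Isom(ℍ)` that is
  `Π` of the quotient orbicurve `[X/Aut X]` (campaign-L junction, GAP row G-L4t14-R1; not constructed).

Refereed pre-IUT material; nothing here bears on [IUTchIII] Cor. 3.12 or takes a side; typed ≠ proved;
model ≠ reconstruction.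
-/

set_option autoImplicit false

namespace Literature.AnabelianGeometry.AbsoluteAnabelian

namespace LocObj

open _root_.CategoryTheory _root_.Topology
open _root_.ProfiniteGrp.ProfiniteCompletion (completion etaFn denseRange)
open Literature.AlgebraicGeometry.Frobenioids (IsSlimGroup)

universe u

variable {N : Type u} [Group N] {Γ : Subgroup N}

/-- **Slim completion ⟹ trivial centraliser of `η(Γ)`.**  If `[N_N(Γ) : Γ] < ∞` and the profinite
completion `M̂` of `M := N_N(Γ)` is slim, then every `y ∈ M̂` commuting with all `η(γ)`, `γ ∈ Γ`, is
trivial: `y` centralises the open kernel of `M̂ → M/K₀` (`K₀ ⊴ M` the normal core of `Γ`), in which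
`η(K₀)` is dense. [cite: MochizukiAbsTopIII2015, Proposition 4.2 (i) proof p.106] -/
theorem forall_comm_eta_eq_one_of_isSlimGroup
    [hΓM : (Γ.subgroupOf (Subgroup.normalizer (Γ : Set N))).FiniteIndex]
    (hslim : IsSlimGroup (completion (GrpCat.of (Subgroup.normalizer (Γ : Set N))))) :
    ∀ y : completion (GrpCat.of (Subgroup.normalizer (Γ : Set N))),
      (∀ γ : Subgroup.normalizer (Γ : Set N), (γ : N) ∈ Γ →
        y * etaFn (GrpCat.of (Subgroup.normalizer (Γ : Set N))) γ =
          etaFn (GrpCat.of (Subgroup.normalizer (Γ : Set N))) γ * y) → y = 1 := by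
  classical
  set M : Subgroup N := Subgroup.normalizer (Γ : Set N) with hM
  intro y hy
  -- the normal core `K₀` of `Γ` in `M`: finite index, normal, inside `Γ`
  let K₀ : FiniteIndexNormalSubgroup M := { toSubgroup := (Γ.subgroupOf M).normalCore }
  have hK₀Γ : ∀ m : M, m ∈ K₀.toSubgroup → (m : N) ∈ Γ := fun m hm =>
    Subgroup.mem_subgroupOf.mp (Subgroup.normalCore_le _ hm)
  -- the open subgroup `U = ker (M̂ → M/K₀)`
  let pK : completion (GrpCat.of M) →*
      (ProfiniteGrp.ProfiniteCompletion.diagram (GrpCat.of M)).obj K₀ :=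
    { toFun := fun z => z.val K₀
      map_one' := rfl
      map_mul' := fun _ _ => rfl }
  have hpK_cont : Continuous pK :=
    (continuous_apply K₀).comp continuous_subtype_val
  haveI : DiscreteTopology ((ProfiniteGrp.ProfiniteCompletion.diagram (GrpCat.of M)).obj K₀) := ⟨rfl⟩
  let U : Subgroup (completion (GrpCat.of M)) := pK.ker
  have hUopen : IsOpen (U : Set (completion (GrpCat.of M))) := by
    have : (U : Set (completion (GrpCat.of M))) = pK ⁻¹' {1} := by
      ext z; simp [U, MonoidHom.mem_ker]
    rw [this]
    exact (isOpen_discrete _).preimage hpK_cont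
  -- `y` commutes with `η(K₀)`, which is dense in `U`; commutation is a closed condition
  have hcomm : ∀ z ∈ U, z * y = y * z := by
    intro z hz
    by_contra hne
    have hSopen : IsOpen ((U : Set (completion (GrpCat.of M))) ∩ {w | w * y ≠ y * w}) := by
      refine hUopen.inter ?_
      have : IsClosed {w : completion (GrpCat.of M) | w * y = y * w} :=
        isClosed_eq (continuous_id.mul continuous_const) (continuous_const.mul continuous_id)
      simpa [Set.compl_setOf] using this.isOpen_compl
    obtain ⟨m, hm⟩ := (denseRange (GrpCat.of M)).exists_mem_open hSopen ⟨z, hz, hne⟩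
    obtain ⟨hmU, hmne⟩ := hm
    -- `η(m) ∈ U` means `m ∈ K₀ ⊆ Γ`
    have hmK : m ∈ K₀.toSubgroup := by
      have : pK (etaFn (GrpCat.of M) m) = 1 := (MonoidHom.mem_ker).mp hmU
      exact (QuotientGroup.eq_one_iff m).mp this
    exact hmne (hy m (hK₀Γ m hmK)).symm
  -- slimness: the centraliser of the open subgroup `U` is trivial
  have hyc : y ∈ Subgroup.centralizer (U : Set (completion (GrpCat.of M))) := by
    rw [Subgroup.mem_centralizer_iff]
    intro z hz
    exact hcomm z hz
  rw [hslim.centralizer_eq_bot U hUopen] at hyc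
  exact (Subgroup.mem_bot).mp hyc

/-- **[AbsTopIII] Prop 4.2 (i), `Loc_R(X)` step, in the group model with print's hypothesis shape:
`[N_N(Γ) : Γ] < ∞` and the profinite completion of `N_N(Γ)` SLIM ⟹ `Loc(N, Γ)` is id-rigid.**
For `Γ = π₁(X) ≤ N = Isom(ℍ)` the completion is `Π_{[X/Aut X]}` and the hypothesis is Lemma 4.3 for
that orbicurve (junction not constructed here). [cite: MochizukiAbsTopIII2015, Proposition 4.2 (i) proof p.106] -/
theorem isIdRigid_of_isSlimGroup_completion_normalizer
    [(Γ.subgroupOf (Subgroup.normalizer (Γ : Set N))).FiniteIndex]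
    (hslim : IsSlimGroup (completion (GrpCat.of (Subgroup.normalizer (Γ : Set N))))) :
    IsIdRigid (LocObj Γ) :=
  isIdRigid_of_completion_normalizer (forall_comm_eta_eq_one_of_isSlimGroup hslim)

end LocObj

end Literature.AnabelianGeometry.AbsoluteAnabelian
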